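import Summits.SmoothPoincare4.SmoothPoincare4.Theorems.ConvexBisectionContractibleTwistedDoubleStandardStubBallHalfSmooth
import Literature.AlgebraicTopology.FundamentalGroup.SphereSimplyConnected
import Mathlib.AlgebraicTopology.FundamentalGroupoid.SimplyConnected
import Mathlib.Geometry.Manifold.Diffeomorph
import HarnessLib

/-!
# Sector bookkeeping for line `property-r-mazur-halves` of crux `ConvexBisection.ContractibleTwistedDoubleStandard`
(item stmt-SmoothPoincare4-3546, route route-SmoothPoincare4-ConvexBisection; skeletons m7 → m8 → m9)

Skeleton m7 (lead c3) left as residual stub `stub_nonSmallSector` the crux restricted to bisections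
whose halves are NOT BOTH smoothly small (small = an adapted Morse function, Milnor 1965 Def. 3.1,
of ball profile — at most one critical point — or of Mazur profile — indices `≤ 2` and exactly one
critical point of each index `0, 1, 2`).  Skeleton m8 (lead c4) replaced "not both small" by
"neither half a ball, and not both Mazur", and skeleton m9 (lead c4) replaced "neither half a ball"
by the single hypothesis "the seam `∂W₁` is not simply connected".  This file proves,
kernel-checked, that the two reshapes only SHRANK the residual:

* `simplyConnectedSpace_boundary_of_homeomorph_sphere` — if some boundary datum of `W` has
  carrier homeomorphic to `S³`, the abstract boundary `(𝓡∂ 4).boundary W` is simply connected;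
* `nonempty_diffeomorph_closedBall_of_isMorseAdapted_of_subsingleton` — a compact nonempty Stein
  domain with an adapted Morse function having at most one critical point is `𝔻⁴` (Milnor's disc
  theorem; copied from the landed `stub_ballHalfSmooth` file, where it is private);
* `nonSmallSectorM8_of_m7` — m7's residual `NonSmallSectorM7` IMPLIES m8's residual
  `NonSmallSectorM8` (pure logic: small = ball ∨ Mazur);
* `nonSmallSectorM9_of_m8` — m8's residual IMPLIES m9's residual `NonSmallSectorM9`: given the
  crux data and m9's hypotheses, if some half is a ball its boundary is `S³`, so (through the seam
  diffeomorphism of the landed `stub_seam` when the ball is `W₂`) `∂W₁` is simply connected,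
  contradiction;
* `nonSmallSectorM9_of_m7` — the composite: m7's residual IMPLIES m9's residual (the three
  registered `stub_nonSmallSector` statements are displayed verbatim as `def … : Prop`).  So
  promoting the m9 residual asks for no more than promoting the m7 (or the m8) residual.
-/

noncomputable section

-- the prescribed namespace `Summit.<P>.<Sub>.…` duplicates `SmoothPoincare4` (P = Sub)
set_option linter.dupNamespace false

open scoped Manifold ContDiff Topology
open Set Function Literature.Topology.FourManifolds Literature.Geometry.Symplectic

namespace Summit.SmoothPoincare4.SmoothPoincare4.Cruxes.ContractibleTwistedDoubleStandard.PropertyRMazurHalves.Bookkeeping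

/-! ### Simply connected seams -/

/-- **A `4`-manifold with boundary whose boundary datum is homeomorphic to `S³` has simply
connected abstract boundary.**  The carrier of a boundary datum `b` is homeomorphic to the
subspace `(𝓡∂ 4).boundary W` (its inclusion is an embedding with that range), and `S³` is simply
connected (Hatcher, Prop. 1.14); simple connectivity is a homotopy invariant.
[cite: HatcherAT2002, Prop. 1.14] -/
theorem simplyConnectedSpace_boundary_of_homeomorph_sphere {W : Type*} [TopologicalSpace W]
    [ChartedSpace (EuclideanHalfSpace 4) W] (b : BoundaryData (𝓡∂ 4) W (𝓡 3))
    (σ : b.carrier ≃ₜ Metric.sphere (0 : EuclideanSpace ℝ (Fin 4)) 1) :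
    SimplyConnectedSpace ((𝓡∂ 4).boundary W) := by
  have θ : b.carrier ≃ₜ ((𝓡∂ 4).boundary W) :=
    b.isSmoothEmbedding.isEmbedding.toHomeomorph.trans (Homeomorph.setCongr b.range_incl)
  haveI : SimplyConnectedSpace (Metric.sphere (0 : EuclideanSpace ℝ (Fin 4)) 1) :=
    Literature.AlgebraicTopology.FundamentalGroup.simplyConnectedSpace_euclideanSphere 3
      (by norm_num)
  exact (θ.symm.trans σ).toHomotopyEquiv.simplyConnectedSpace

/-! ### A Stein domain carrying an adapted Morse function with at most one critical point is a `4`-ball -/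

-- adapted from `…Theorems.ConvexBisectionContractibleTwistedDoubleStandardStubBallHalfSmooth`
-- (private there)
/-- **The minimum of the `J`-convex function of a nonempty Stein domain is an interior point**
(equivalently, lies below the maximum): otherwise `φ` is constant, so `dφ = 0` at the minimum,
which is then a boundary point (`SteinStructure.boundary_eq`) where `dφ ≠ 0`
(`SteinStructure.regular`).  Gompf, *Handlebody construction of Stein surfaces* (1998), §1 (the
boundary of a Stein domain is the regular maximal level set). [folklore] -/
private theorem isInteriorPoint_of_isMinOn_φ {W : Type*} [TopologicalSpace W]
    [ChartedSpace (EuclideanHalfSpace 4) W] [IsManifold (𝓡∂ 4) ∞ W] [CompactSpace W]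
    (S : SteinStructure W) {p : W} (hp : IsMinOn S.φ univ p) :
    (𝓡∂ 4).IsInteriorPoint p := by
  refine (S.isInteriorPoint_iff_φ_lt p).2 ?_
  by_contra hge
  have hpeq : S.φ p = sSup (range S.φ) := le_antisymm (S.φ_le_sSup p) (not_lt.1 hge)
  have hconst : ∀ y, S.φ y = sSup (range S.φ) := fun y =>
    le_antisymm (S.φ_le_sSup y) (hpeq.ge.trans (hp (mem_univ y)))
  have hpb : (𝓡∂ 4).IsBoundaryPoint p := (S.boundary_eq p).2 hpeq
  refine S.regular p hpb ?_
  have hfun : S.φ = fun _ => sSup (range S.φ) := funext hconst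
  rw [hfun]
  exact mfderiv_const

-- adapted from `…Theorems.ConvexBisectionContractibleTwistedDoubleStandardStubBallHalfSmooth`
-- (private there)
/-- **A compact nonempty Stein domain carrying a Morse function adapted to the boundary with at
most one critical point is diffeomorphic to `𝔻⁴`.**  The interior of `W` is nonempty (the minimum
of `φ` lies in it, `isInteriorPoint_of_isMinOn_φ`) and `f < 1` there while `f = 1` on `∂W`
(Milnor 1965, Def. 3.1), so the minimum `p` of `f` is an interior point, hence a critical point
(Fermat, `isMCriticalPt_of_isLocalMin`), hence the only one, an interior local minimum; Milnor's
disc theorem (`nonempty_diffeomorph_closedBall_of_isMorseAdapted_of_isLocalMin`) gives `W ≅ 𝔻⁴`.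
[cite: Milnor1963, Thm. 3.1 and Lemma 2.2] -/
theorem nonempty_diffeomorph_closedBall_of_isMorseAdapted_of_subsingleton
    {W : Type*} [TopologicalSpace W] [T2Space W] [ChartedSpace (EuclideanHalfSpace 4) W]
    [IsManifold (𝓡∂ 4) ∞ W] [CompactSpace W] [Nonempty W] (S : SteinStructure W)
    {f : W → ℝ} (hf : IsMorseAdapted (𝓡∂ 4) f) (hsub : (criticalSet (𝓡∂ 4) f).Subsingleton) :
    Nonempty (W ≃ₘ⟮𝓡∂ 4, 𝓡∂ 4⟯ Metric.closedBall (0 : EuclideanSpace ℝ (Fin 4)) 1) := by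
  -- an interior point `q`, where `f q < 1`
  obtain ⟨q, -, hq⟩ :=
    isCompact_univ.exists_isMinOn univ_nonempty S.φ_smooth.continuous.continuousOn
  have hqi : (𝓡∂ 4).IsInteriorPoint q := isInteriorPoint_of_isMinOn_φ S hq
  have hfq : f q < 1 := hf.2.2 q hqi
  -- the minimum `p` of `f` is an interior point, hence the unique critical point
  obtain ⟨p, -, hp⟩ :=
    isCompact_univ.exists_isMinOn univ_nonempty hf.isMorse.contMDiff.continuous.continuousOn
  have hpq : f p ≤ f q := hp (mem_univ q)
  have hpi : (𝓡∂ 4).IsInteriorPoint p := by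
    rcases (𝓡∂ 4).isInteriorPoint_or_isBoundaryPoint p with hpi | hpb
    · exact hpi
    · exact absurd ((hf.2.1 p hpb).1 ▸ hpq) (not_le.2 hfq)
  have hplocal : IsLocalMin f p := hp.isLocalMin Filter.univ_mem
  have hpcrit : IsMCriticalPt (𝓡∂ 4) f p := isMCriticalPt_of_isLocalMin hplocal hpi
  have huniq : ∀ x, IsMCriticalPt (𝓡∂ 4) f x → x = p := fun x hx => hsub hx hpcrit
  exact nonempty_diffeomorph_closedBall_of_isMorseAdapted_of_isLocalMin hf hplocal hpi huniq

/-! ### The two residual statements, verbatim -/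

/-- **m7's residual stub `stub_nonSmallSector` (skeleton m7, lead c3), VERBATIM as a proposition.**
The crux restricted to bisections whose halves are NOT BOTH smoothly small: crux data, then
`¬ (small W₁ ∧ small W₂)` with small = an adapted Morse function whose critical set is a
subsingleton (ball) or whose indices are `≤ 2` with exactly one critical point of each index
`0, 1, 2` (Mazur), then `X ≅ S⁴`. [folklore] -/
def NonSmallSectorM7 : Prop :=
  ∀ (X : Type) [TopologicalSpace X] [T2Space X] [SecondCountableTopology X] [CompactSpace X]
    [ChartedSpace (EuclideanSpace ℝ (Fin 4)) X] [IsManifold (𝓡 4) ∞ X]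
    (W₁ : Type) [TopologicalSpace W₁] [ChartedSpace (EuclideanHalfSpace 4) W₁]
    [IsManifold (𝓡∂ 4) ∞ W₁] [CompactSpace W₁] [ContractibleSpace W₁]
    (W₂ : Type) [TopologicalSpace W₂] [ChartedSpace (EuclideanHalfSpace 4) W₂]
    [IsManifold (𝓡∂ 4) ∞ W₂] [CompactSpace W₂] [ContractibleSpace W₂]
    (J₁ : SteinStructure W₁) (J₂ : SteinStructure W₂) (e₁ : W₁ → X) (e₂ : W₂ → X),
    Manifold.IsSmoothEmbedding (𝓡∂ 4) (𝓡 4) ∞ e₁ → Manifold.IsSmoothEmbedding (𝓡∂ 4) (𝓡 4) ∞ e₂ →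
    Set.range e₁ ∪ Set.range e₂ = Set.univ →
    Set.range e₁ ∩ Set.range e₂ = e₁ '' (𝓡∂ 4).boundary W₁ →
    Set.range e₁ ∩ Set.range e₂ = e₂ '' (𝓡∂ 4).boundary W₂ →
    (∀ w₁ w₂, e₁ w₁ = e₂ w₂ →
      Submodule.map (mfderiv (𝓡∂ 4) (𝓡 4) e₁ w₁).toLinearMap (contactPlane J₁.J w₁) =
        Submodule.map (mfderiv (𝓡∂ 4) (𝓡 4) e₂ w₂).toLinearMap (contactPlane J₂.J w₂)) →
    ¬ ((∃ f : W₁ → ℝ, IsMorseAdapted (𝓡∂ 4) f ∧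
          ((criticalSet (𝓡∂ 4) f).Subsingleton ∨
            ((∀ z, IsMCriticalPt (𝓡∂ 4) f z → morseIndex (𝓡∂ 4) f z ≤ 2) ∧
              (criticalSetOfIndex (𝓡∂ 4) f 0).ncard = 1 ∧ (criticalSetOfIndex (𝓡∂ 4) f 1).ncard = 1 ∧
              (criticalSetOfIndex (𝓡∂ 4) f 2).ncard = 1))) ∧
        (∃ f : W₂ → ℝ, IsMorseAdapted (𝓡∂ 4) f ∧
          ((criticalSet (𝓡∂ 4) f).Subsingleton ∨
            ((∀ z, IsMCriticalPt (𝓡∂ 4) f z → morseIndex (𝓡∂ 4) f z ≤ 2) ∧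
              (criticalSetOfIndex (𝓡∂ 4) f 0).ncard = 1 ∧ (criticalSetOfIndex (𝓡∂ 4) f 1).ncard = 1 ∧
              (criticalSetOfIndex (𝓡∂ 4) f 2).ncard = 1)))) →
    Nonempty (X ≃ₘ⟮𝓡 4, 𝓡 4⟯ Metric.sphere (0 : EuclideanSpace ℝ (Fin 5)) 1)

/-- **m8's residual stub `stub_nonSmallSector` (skeleton m8a, lead c4, sha 539c352f…), VERBATIM as a
proposition.**  The crux restricted to bisections with NEITHER half smoothly a ball and NOT BOTH
halves smoothly Mazur: crux data, then `¬ ball W₁`, `¬ ball W₂` (ball = an adapted Morse function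
whose critical set is a subsingleton), then `¬ (mazur W₁ ∧ mazur W₂)`, then `X ≅ S⁴`. [folklore] -/
def NonSmallSectorM8 : Prop :=
  ∀ (X : Type) [TopologicalSpace X] [T2Space X] [SecondCountableTopology X] [CompactSpace X]
    [ChartedSpace (EuclideanSpace ℝ (Fin 4)) X] [IsManifold (𝓡 4) ∞ X]
    (W₁ : Type) [TopologicalSpace W₁] [ChartedSpace (EuclideanHalfSpace 4) W₁]
    [IsManifold (𝓡∂ 4) ∞ W₁] [CompactSpace W₁] [ContractibleSpace W₁]
    (W₂ : Type) [TopologicalSpace W₂] [ChartedSpace (EuclideanHalfSpace 4) W₂]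
    [IsManifold (𝓡∂ 4) ∞ W₂] [CompactSpace W₂] [ContractibleSpace W₂]
    (J₁ : SteinStructure W₁) (J₂ : SteinStructure W₂) (e₁ : W₁ → X) (e₂ : W₂ → X),
    Manifold.IsSmoothEmbedding (𝓡∂ 4) (𝓡 4) ∞ e₁ → Manifold.IsSmoothEmbedding (𝓡∂ 4) (𝓡 4) ∞ e₂ →
    Set.range e₁ ∪ Set.range e₂ = Set.univ →
    Set.range e₁ ∩ Set.range e₂ = e₁ '' (𝓡∂ 4).boundary W₁ →
    Set.range e₁ ∩ Set.range e₂ = e₂ '' (𝓡∂ 4).boundary W₂ →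
    (∀ w₁ w₂, e₁ w₁ = e₂ w₂ →
      Submodule.map (mfderiv (𝓡∂ 4) (𝓡 4) e₁ w₁).toLinearMap (contactPlane J₁.J w₁) =
        Submodule.map (mfderiv (𝓡∂ 4) (𝓡 4) e₂ w₂).toLinearMap (contactPlane J₂.J w₂)) →
    ¬ (∃ f : W₁ → ℝ, IsMorseAdapted (𝓡∂ 4) f ∧ (criticalSet (𝓡∂ 4) f).Subsingleton) →
    ¬ (∃ f : W₂ → ℝ, IsMorseAdapted (𝓡∂ 4) f ∧ (criticalSet (𝓡∂ 4) f).Subsingleton) →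
    ¬ ((∃ f : W₁ → ℝ, IsMorseAdapted (𝓡∂ 4) f ∧
          (∀ z, IsMCriticalPt (𝓡∂ 4) f z → morseIndex (𝓡∂ 4) f z ≤ 2) ∧
          (criticalSetOfIndex (𝓡∂ 4) f 0).ncard = 1 ∧ (criticalSetOfIndex (𝓡∂ 4) f 1).ncard = 1 ∧
          (criticalSetOfIndex (𝓡∂ 4) f 2).ncard = 1) ∧
        (∃ f : W₂ → ℝ, IsMorseAdapted (𝓡∂ 4) f ∧
          (∀ z, IsMCriticalPt (𝓡∂ 4) f z → morseIndex (𝓡∂ 4) f z ≤ 2) ∧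
          (criticalSetOfIndex (𝓡∂ 4) f 0).ncard = 1 ∧ (criticalSetOfIndex (𝓡∂ 4) f 1).ncard = 1 ∧
          (criticalSetOfIndex (𝓡∂ 4) f 2).ncard = 1)) →
    Nonempty (X ≃ₘ⟮𝓡 4, 𝓡 4⟯ Metric.sphere (0 : EuclideanSpace ℝ (Fin 5)) 1)

/-- **m9's residual stub `stub_nonSmallSector` (skeleton m9, lead c4), VERBATIM as a proposition.**
The crux restricted to bisections whose seam `∂W₁` is NOT simply connected and whose halves are
NOT BOTH smoothly Mazur: crux data, then `¬ SimplyConnectedSpace (∂W₁)`, then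
`¬ (mazur W₁ ∧ mazur W₂)`, then `X ≅ S⁴`. [folklore] -/
def NonSmallSectorM9 : Prop :=
  ∀ (X : Type) [TopologicalSpace X] [T2Space X] [SecondCountableTopology X] [CompactSpace X]
    [ChartedSpace (EuclideanSpace ℝ (Fin 4)) X] [IsManifold (𝓡 4) ∞ X]
    (W₁ : Type) [TopologicalSpace W₁] [ChartedSpace (EuclideanHalfSpace 4) W₁]
    [IsManifold (𝓡∂ 4) ∞ W₁] [CompactSpace W₁] [ContractibleSpace W₁]
    (W₂ : Type) [TopologicalSpace W₂] [ChartedSpace (EuclideanHalfSpace 4) W₂]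
    [IsManifold (𝓡∂ 4) ∞ W₂] [CompactSpace W₂] [ContractibleSpace W₂]
    (J₁ : SteinStructure W₁) (J₂ : SteinStructure W₂) (e₁ : W₁ → X) (e₂ : W₂ → X),
    Manifold.IsSmoothEmbedding (𝓡∂ 4) (𝓡 4) ∞ e₁ → Manifold.IsSmoothEmbedding (𝓡∂ 4) (𝓡 4) ∞ e₂ →
    Set.range e₁ ∪ Set.range e₂ = Set.univ →
    Set.range e₁ ∩ Set.range e₂ = e₁ '' (𝓡∂ 4).boundary W₁ →
    Set.range e₁ ∩ Set.range e₂ = e₂ '' (𝓡∂ 4).boundary W₂ →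
    (∀ w₁ w₂, e₁ w₁ = e₂ w₂ →
      Submodule.map (mfderiv (𝓡∂ 4) (𝓡 4) e₁ w₁).toLinearMap (contactPlane J₁.J w₁) =
        Submodule.map (mfderiv (𝓡∂ 4) (𝓡 4) e₂ w₂).toLinearMap (contactPlane J₂.J w₂)) →
    ¬ SimplyConnectedSpace ((𝓡∂ 4).boundary W₁) →
    ¬ ((∃ f : W₁ → ℝ, IsMorseAdapted (𝓡∂ 4) f ∧
          (∀ z, IsMCriticalPt (𝓡∂ 4) f z → morseIndex (𝓡∂ 4) f z ≤ 2) ∧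
          (criticalSetOfIndex (𝓡∂ 4) f 0).ncard = 1 ∧ (criticalSetOfIndex (𝓡∂ 4) f 1).ncard = 1 ∧
          (criticalSetOfIndex (𝓡∂ 4) f 2).ncard = 1) ∧
        (∃ f : W₂ → ℝ, IsMorseAdapted (𝓡∂ 4) f ∧
          (∀ z, IsMCriticalPt (𝓡∂ 4) f z → morseIndex (𝓡∂ 4) f z ≤ 2) ∧
          (criticalSetOfIndex (𝓡∂ 4) f 0).ncard = 1 ∧ (criticalSetOfIndex (𝓡∂ 4) f 1).ncard = 1 ∧
          (criticalSetOfIndex (𝓡∂ 4) f 2).ncard = 1)) →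
    Nonempty (X ≃ₘ⟮𝓡 4, 𝓡 4⟯ Metric.sphere (0 : EuclideanSpace ℝ (Fin 5)) 1)

/-! ### m7's residual implies m8's, which implies m9's -/

/-- **m7's residual stub implies m8's residual stub** (`NonSmallSectorM7 → NonSmallSectorM8`; the
reshape m7 → m8 only shrank the residual).  Pure logic: given m8's hypotheses `¬ ball W₁`,
`¬ ball W₂`, `¬ (mazur W₁ ∧ mazur W₂)`, m7's hypothesis `¬ (small W₁ ∧ small W₂)`
(small = ball ∨ mazur, for one adapted Morse function) holds — if both halves were small, either
some half is a ball or both are Mazur. [folklore] -/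
theorem nonSmallSectorM8_of_m7 : NonSmallSectorM7 → NonSmallSectorM8 := by
  intro h7 X _ _ _ _ _ _ W₁ _ _ _ _ _ W₂ _ _ _ _ _ J₁ J₂ e₁ e₂ h1 h2 hcov hL hR hC hb1 hb2 hm
  refine h7 X W₁ W₂ J₁ J₂ e₁ e₂ h1 h2 hcov hL hR hC ?_
  rintro ⟨⟨f₁, hf₁, hs₁⟩, ⟨f₂, hf₂, hs₂⟩⟩
  rcases hs₁ with hs₁ | hm1
  · exact hb1 ⟨f₁, hf₁, hs₁⟩
  rcases hs₂ with hs₂ | hm2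
  · exact hb2 ⟨f₂, hf₂, hs₂⟩
  · exact hm ⟨⟨f₁, hf₁, hm1⟩, ⟨f₂, hf₂, hm2⟩⟩

open Summit.SmoothPoincare4.SmoothPoincare4.Theorems.ContractibleTwistedDoubleStandard in
/-- **m8's residual stub implies m9's residual stub** (`NonSmallSectorM8 → NonSmallSectorM9`; the
reshape m8 → m9 only shrank the residual).  Given the crux data and m9's hypotheses
`¬ SimplyConnectedSpace (∂W₁)`, `¬ (mazur W₁ ∧ mazur W₂)`, m8's hypotheses `¬ ball W₁`, `¬ ball W₂`
hold: (a) if `W₁` is a ball then `W₁ ≅ 𝔻⁴`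
(`nonempty_diffeomorph_closedBall_of_isMorseAdapted_of_subsingleton`), a boundary datum of `W₁`
restricts to `∂W₁ ≅ ∂𝔻⁴ = S³` (`BoundaryData.restrictDiffeomorph`, `closedBallBoundaryData 3`), so
`∂W₁` is simply connected (`simplyConnectedSpace_boundary_of_homeomorph_sphere`), contradiction;
(b) if `W₂` is a ball then likewise `∂W₂ ≅ S³`, and the seam diffeomorphism `ψ : ∂W₁ ≅ ∂W₂` of
the landed `stub_seam` gives `∂W₁ ≅ S³`, contradiction. [folklore] -/
theorem nonSmallSectorM9_of_m8 : NonSmallSectorM8 → NonSmallSectorM9 := by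
  intro h8 X _ _ _ _ _ _ W₁ _ _ _ _ _ W₂ _ _ _ _ _ J₁ J₂ e₁ e₂ h1 h2 hcov hL hR hC hsc hm
  -- the halves are Hausdorff and second countable (embedded in `X`)
  haveI : T2Space W₁ := h1.isEmbedding.t2Space
  haveI : T2Space W₂ := h2.isEmbedding.t2Space
  haveI : SecondCountableTopology W₁ := h1.isEmbedding.secondCountableTopology
  haveI : SecondCountableTopology W₂ := h2.isEmbedding.secondCountableTopology
  -- boundary data of the halves and of the ball
  obtain ⟨b₁⟩ : Nonempty (BoundaryData (𝓡∂ 4) W₁ (𝓡 3)) := nonempty_boundaryData_holds 3 W₁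
  obtain ⟨b₂⟩ : Nonempty (BoundaryData (𝓡∂ 4) W₂ (𝓡 3)) := nonempty_boundaryData_holds 3 W₂
  let D : BoundaryData (𝓡∂ 4) (Metric.closedBall (0 : EuclideanSpace ℝ (Fin 4)) 1) (𝓡 3) :=
    closedBallBoundaryData 3
  refine h8 X W₁ W₂ J₁ J₂ e₁ e₂ h1 h2 hcov hL hR hC ?_ ?_ hm
  · -- (a) `W₁` is a ball: `∂W₁ ≅ S³` is simply connected
    rintro ⟨f₁, hf₁, hb1⟩
    obtain ⟨Φ₁⟩ := nonempty_diffeomorph_closedBall_of_isMorseAdapted_of_subsingleton J₁ hf₁ hb1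
    have σ : b₁.carrier ≃ₜ Metric.sphere (0 : EuclideanSpace ℝ (Fin 4)) 1 :=
      (b₁.restrictDiffeomorph D Φ₁).toHomeomorph
    exact hsc (simplyConnectedSpace_boundary_of_homeomorph_sphere b₁ σ)
  · -- (b) `W₂` is a ball: `∂W₁ ≅ ∂W₂ ≅ S³` through the seam diffeomorphism
    rintro ⟨f₂, hf₂, hb2⟩
    obtain ⟨Φ₂⟩ := nonempty_diffeomorph_closedBall_of_isMorseAdapted_of_subsingleton J₂ hf₂ hb2
    obtain ⟨ψ, -, -⟩ :=
      LegendrianRKnotRigidity.stub_seam X W₁ W₂ J₁ J₂ e₁ e₂ h1 h2 hL hR hC b₁ b₂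
    have σ : b₁.carrier ≃ₜ Metric.sphere (0 : EuclideanSpace ℝ (Fin 4)) 1 :=
      (ψ.trans (b₂.restrictDiffeomorph D Φ₂)).toHomeomorph
    exact hsc (simplyConnectedSpace_boundary_of_homeomorph_sphere b₁ σ)

/-- **m7's residual stub implies m9's residual stub** (`NonSmallSectorM7 → NonSmallSectorM9`, both
the registered `stub_nonSmallSector` statements displayed verbatim): the composite of
`nonSmallSectorM8_of_m7` and `nonSmallSectorM9_of_m8`.  So the reshapes m7 → m8 → m9 only shrank
the residual sector: promoting the m9 residual asks for no more than promoting the m7 (or the m8)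
residual. [folklore] -/
theorem nonSmallSectorM9_of_m7 : NonSmallSectorM7 → NonSmallSectorM9 :=
  fun h7 => nonSmallSectorM9_of_m8 (nonSmallSectorM8_of_m7 h7)

end Summit.SmoothPoincare4.SmoothPoincare4.Cruxes.ContractibleTwistedDoubleStandard.PropertyRMazurHalves.Bookkeeping

end
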